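import Literature.NumberTheory.Automorphic.TameLevelScalarFactorisation
import Literature.NumberTheory.Automorphic.GL2AdelicInvariantFunctionsDet
import Literature.NumberTheory.Automorphic.ArithmeticQuotientDegreeZeroHecke
import Mathlib.GroupTheory.Perm.Cycle.Type
import HarnessLib

/-!
# The Hida tower of `GL₂` has no ordinary part in degree `0`

Topic `NumberTheory/Automorphic`; namespace `Literature.NumberTheory.Automorphic.BigHeckeGLn`
(`TameLevel`); theorems only.  Proof file supporting the named fact
`Literature.NumberTheory.Automorphic.hidaControl_dominantOrdinaryPoint` (Hida's control theorem in
consequence form, `BianchiOrdinaryClassicality`): the tree's ordinary big Hecke algebra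
`𝕋^{S,ord}(𝒰) = OrdinaryHeckeAlgebraGLn 𝒰` (`OrdinaryCompletedCohomologyGL`) is built on the
ordinary parts of ALL degrees `H^i(X_{U(r)}, ℤ/p^s)`, whereas the printed theory lives in degrees
`q₀ ≤ i ≤ q₀ + ℓ₀` ([Hida1994AIF, Thm. 2.2]: `q = r₁ + r₂`; [KhareThorne2017, §6.3]).  Here the
degree `i = 0` is disposed of for `GL₂` over any number field `K`:

* `pow_unipotentUpper`-type facts: the local unipotent `n(b) = (1 b; 0 1) ∈ GL₂(K_v)`
  (`unipotentOfSqZero` of the tree) embedded at `v` lies in every Hida level `U(r)`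
  (`ofLocal_unipotent_mem_hidaLevel`, for `U` maximal above `p`).
* `conj_mem_hidaLevel_of_valued_le` — for `l ∈ U(r)` and `|b|_v ≤ |ϖ_v|`,
  `t⁻¹ (l⁻¹ n(b) l) t ∈ U(r)` (`t = t_{v,1} = diag(ϖ_v, 1)`): `n(b)`, `b ∈ 𝔪_v`, fixes every
  coset of `U(r) t U(r) / U(r)` (Iwahori conditions are stable under `t`-conjugation of matrices
  with top-right entry divisible by `ϖ_v`, `IwahoriCond.cutDiag_conj`).
* `conj_not_mem_hidaLevel` — for `l ∈ U(r)`, `t⁻¹ (l⁻¹ n(1) l) t ∉ U(r)`: `n(1)` fixes NO coset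
  (the top-right entry `(l⁻¹)₀₀ l₁₁` of `l⁻¹ n(1) l` is a unit).
* `dvd_card_doubleCosetQuot_hidaLevel` — hence **`p ∣ #(U(r) t_{v,1} U(r) / U(r))`**: the
  permutation `n(1) • ·` of this finite set satisfies `σ^p = n(p) • · = 1` and has no fixed point
  (Mathlib `Equiv.Perm.card_fixedPoints_modEq`).  (In fact `# = q_v`; only `p ∣ #` is needed.)
* `TameLevel.ordinaryPart_zero_eq_bot` — **`H⁰(X_{U(r)}, ℤ/p^s)^{ord} = 0`** for `GL₂` and `U`
  maximal above `p`: on `H⁰ = ` invariant functions (`ArithmeticQuotientDegreeZeroHecke`), which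
  factor through `det` (`GL2AdelicInvariantFunctionsDet`, strong approximation), `U_{v,1}^s` is
  multiplication by `#(UtU/U)^s ≡ 0 (mod p^s)` composed with a translation, hence `0`; so the
  Hecke-stable hull `⋂_m 𝕋 · U_{v,1}^m H⁰` defining the ordinary part vanishes.

## References

* H. Hida, *p-adic ordinary Hecke algebras for GL(2)*, Ann. Inst. Fourier 44 (1994), §2,
  Thm. 2.2 (held; read 2026-08-16). [Hida1994AIF]
* C. Khare, J. A. Thorne, *Potential automorphy and the Leopoldt conjecture*, Amer. J. Math. 139
  (2017), §6.2 Lemma 6.5, §6.3 (arXiv:1409.7007, held; read 2026-08-16). [KhareThorne2017]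
-/

noncomputable section

open scoped NumberField
open IsDedekindDomain

namespace Literature.NumberTheory.Automorphic.BigHeckeGLn

variable {K : Type} [Field K] [NumberField K]

/-! ### The local unipotent `n(b) = (1 b; 0 1)` -/

section Unipotent

variable (v : HeightOneSpectrum (𝓞 K))

/-- `(b E₀₁)² = 0`. [folklore] -/
theorem single_zero_one_mul_self (b : v.adicCompletion K) :
    Matrix.single (0 : Fin 2) (1 : Fin 2) b * Matrix.single (0 : Fin 2) (1 : Fin 2) b = 0 :=
  Matrix.single_mul_single_of_ne b 0 1 0 (by decide) b

/-- Entries of `P (1 + b E₀₁) Q` for `P Q = 1`: `δ_{jk} + P_{j0} b Q_{1k}`. [folklore] -/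
theorem mul_one_add_single_mul_apply {R : Type*} [CommRing R] {P Q : Matrix (Fin 2) (Fin 2) R}
    (hPQ : P * Q = 1) (b : R) (j k : Fin 2) :
    (P * (1 + Matrix.single (0 : Fin 2) (1 : Fin 2) b) * Q) j k =
      (1 : Matrix (Fin 2) (Fin 2) R) j k + P j 0 * b * Q 1 k := by
  rw [mul_add, mul_one, add_mul, hPQ, Matrix.add_apply]
  congr 1
  simp [Matrix.mul_apply, Fin.sum_univ_two, Matrix.single_apply]

/-- The unipotent `n(b)`, `|b| ≤ 1`, satisfies every Iwahori condition, and so does its inverse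
`n(-b)`. [folklore] -/
theorem unipotent_mem_valuedIwahoriSubgroup {b : v.adicCompletion K} (hb : Valued.v b ≤ 1)
    (β γ : WithZero (Multiplicative ℤ)) :
    unipotentOfSqZero (Matrix.single (0 : Fin 2) (1 : Fin 2) b) (single_zero_one_mul_self v b) ∈
      valuedIwahoriSubgroup (Fin 2) β γ := by
  have hcond : ∀ c : v.adicCompletion K, Valued.v c ≤ 1 →
      IwahoriCond (Fin 2) β γ (1 + Matrix.single (0 : Fin 2) (1 : Fin 2) c) := fun c hc => by
    refine ⟨fun i j => ?_, fun i j hij => ?_, fun i => ?_⟩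
    · fin_cases i <;> fin_cases j <;> simp [hc]
    · fin_cases i <;> fin_cases j <;> simp at hij ⊢
    · fin_cases i <;> simp
  refine ⟨by simpa using hcond b hb, ?_⟩
  rw [coe_unipotentOfSqZero_inv, sub_eq_add_neg, Matrix.single_neg]
  exact hcond (-b) (by rwa [Valuation.map_neg])

end Unipotent

/-! ### `n(b)` at `v` in the Hida tower: fixes every coset of `U t U / U` for `b ∈ 𝔪_v`, none for
`b = 1` -/

namespace TameLevel

variable {p : ℕ} [Fact p.Prime] {𝒰 : TameLevel 2 K p}

/-- Conjugation of a finite-adelic element by a local element `ι_v(g)` factors as the `v`-deprived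
part of `y` times `ι_v(g⁻¹ y_v g)` (restated; private in `OrdinaryCompletedCohomologyGL`). [folklore] -/
theorem conj_ofLocal_eq_mul_ofLocal' (v : HeightOneSpectrum (𝓞 K))
    (g : GL (Fin 2) (v.adicCompletion K)) (y : FiniteAdelicGL 2 K) :
    (ofLocal 2 K v g)⁻¹ * y * ofLocal 2 K v g =
      y * (ofLocal 2 K v (localComponent 2 K v y))⁻¹ *
        ofLocal 2 K v (g⁻¹ * localComponent 2 K v y * g) := by
  refine ext_localComponent fun w => ?_
  by_cases hw : w = v
  · subst hw
    simp only [map_mul, map_inv, localComponent_ofLocal]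
    rw [mul_inv_cancel, one_mul]
  · simp only [map_mul, map_inv, localComponent_ofLocal_of_ne hw, inv_one, one_mul, mul_one]

/-- **`ι_v(n(b)) ∈ U(r)`** for `|b|_v ≤ 1` and `U` maximal above `p`. [folklore] -/
theorem ofLocal_unipotent_mem_hidaLevel (h𝒰 : 𝒰.IsMaximalAbove) {v : HeightOneSpectrum (𝓞 K)}
    (hv : (p : 𝓞 K) ∈ v.asIdeal) {b : v.adicCompletion K} (hb : Valued.v b ≤ 1) (r : ℕ) :
    ofLocal 2 K v (unipotentOfSqZero (Matrix.single (0 : Fin 2) (1 : Fin 2) b)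
      (single_zero_one_mul_self v b)) ∈ 𝒰.hidaLevel r := by
  rw [mem_hidaLevel_iff]
  refine ⟨h𝒰.ofLocal_mem v hv _ (valuedIwahoriSubgroup_le_valuedCongruenceSubgroup_one
    (unipotent_mem_valuedIwahoriSubgroup v hb 1 1)), fun w hw => ?_⟩
  by_cases hwv : w = v
  · subst hwv
    rw [localComponent_ofLocal]
    exact unipotent_mem_valuedIwahoriSubgroup w hb _ _
  · rw [localComponent_ofLocal_of_ne hwv]
    exact one_mem _

/-- The `v`-component of `l⁻¹ ι_v(n(b)) l` is `l_v⁻¹ n(b) l_v`, with entries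
`δ_{jk} + (l_v⁻¹)_{j0} b (l_v)_{1k}`. [folklore] -/
theorem coe_localComponent_conj_unipotent_apply (v : HeightOneSpectrum (𝓞 K))
    (l : FiniteAdelicGL 2 K) (b : v.adicCompletion K) (j k : Fin 2) :
    ((localComponent 2 K v (l⁻¹ * ofLocal 2 K v (unipotentOfSqZero
        (Matrix.single (0 : Fin 2) (1 : Fin 2) b) (single_zero_one_mul_self v b)) * l) :
        GL (Fin 2) (v.adicCompletion K)) : Matrix (Fin 2) (Fin 2) (v.adicCompletion K)) j k =
      (1 : Matrix (Fin 2) (Fin 2) (v.adicCompletion K)) j k +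
        (((localComponent 2 K v l)⁻¹ : GL (Fin 2) (v.adicCompletion K)) :
          Matrix (Fin 2) (Fin 2) (v.adicCompletion K)) j 0 * b *
        ((localComponent 2 K v l : GL (Fin 2) (v.adicCompletion K)) :
          Matrix (Fin 2) (Fin 2) (v.adicCompletion K)) 1 k := by
  rw [map_mul, map_mul, map_inv, localComponent_ofLocal, Units.val_mul, Units.val_mul,
    coe_unipotentOfSqZero]
  exact mul_one_add_single_mul_apply (Units.inv_mul _) b j k

/-- **`n(b)`, `b ∈ 𝔪_v`, fixes every coset of `U(r) t_{v,1} U(r) / U(r)`**: for `l ∈ U(r)` and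
`|b|_v ≤ |ϖ_v|`, `t⁻¹ (l⁻¹ ι_v(n(b)) l) t ∈ U(r)` — the `v`-component `l_v⁻¹ n(b) l_v` lies in the
Iwahori level and has top-right entry divisible by `ϖ_v`, so its `t`-conjugate stays in the level
(`IwahoriCond.cutDiag_conj`). [cite: KhareThorne2017, §6.2 Lemma 6.5] -/
theorem conj_mem_hidaLevel_of_valued_le (h𝒰 : 𝒰.IsMaximalAbove) {v : HeightOneSpectrum (𝓞 K)}
    (hv : (p : 𝓞 K) ∈ v.asIdeal) {r : ℕ} {l : FiniteAdelicGL 2 K} (hl : l ∈ 𝒰.hidaLevel r)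
    {b : v.adicCompletion K}
    (hb : Valued.v b ≤ Valued.v ((uniformizerAt v : (v.adicCompletion K)ˣ) : v.adicCompletion K)) :
    (heckeElement 2 K v 1)⁻¹ * (l⁻¹ * ofLocal 2 K v (unipotentOfSqZero
      (Matrix.single (0 : Fin 2) (1 : Fin 2) b) (single_zero_one_mul_self v b)) * l) *
      heckeElement 2 K v 1 ∈ 𝒰.hidaLevel r := by
  have hϖ1 : Valued.v ((uniformizerAt v : (v.adicCompletion K)ˣ) : v.adicCompletion K) ≤ 1 := by
    rw [valued_coe_uniformizerAt, ← WithZero.exp_zero]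
    exact WithZero.exp_le_exp.2 (by norm_num)
  have hb1 : Valued.v b ≤ 1 := hb.trans hϖ1
  set y : FiniteAdelicGL 2 K := l⁻¹ * ofLocal 2 K v (unipotentOfSqZero
    (Matrix.single (0 : Fin 2) (1 : Fin 2) b) (single_zero_one_mul_self v b)) * l with hy
  have hyU : y ∈ 𝒰.hidaLevel r :=
    mul_mem (mul_mem (inv_mem hl) (ofLocal_unipotent_mem_hidaLevel h𝒰 hv hb1 r)) hl
  obtain ⟨hyS, hyw⟩ := (mem_hidaLevel_iff 𝒰 r y).1 hyU
  obtain ⟨hlS, hlw⟩ := (mem_hidaLevel_iff 𝒰 r l).1 hl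
  set tl : GL (Fin 2) (v.adicCompletion K) := cutDiag (uniformizerAt v) 1 with htl
  have ht : heckeElement 2 K v 1 = ofLocal 2 K v tl := heckeElement_eq_ofLocal_cutDiag v 1
  -- the `v`-component of `y` and its top-right divisibility
  have hyv := hyw v hv
  have hdiv : TopRightDivisible (uniformizerAt v) 1 ((localComponent 2 K v y :
      GL (Fin 2) (v.adicCompletion K)) : Matrix (Fin 2) (Fin 2) (v.adicCompletion K)) := by
    intro j k hj hk
    have hj0 : j = 0 := Fin.ext (by simp only [Fin.val_zero]; omega)
    have hk1 : k = 1 := Fin.ext (by have := k.isLt; simp only [Fin.val_one]; omega)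
    subst hj0 hk1
    rw [hy, coe_localComponent_conj_unipotent_apply, Matrix.one_apply_ne (by decide), zero_add,
      map_mul, map_mul]
    calc Valued.v ((((localComponent 2 K v l)⁻¹ : GL (Fin 2) (v.adicCompletion K)) :
          Matrix (Fin 2) (Fin 2) (v.adicCompletion K)) 0 0) * Valued.v b *
          Valued.v (((localComponent 2 K v l : GL (Fin 2) (v.adicCompletion K)) :
            Matrix (Fin 2) (Fin 2) (v.adicCompletion K)) 1 1)
        ≤ 1 * Valued.v ((uniformizerAt v : (v.adicCompletion K)ˣ) : v.adicCompletion K) * 1 :=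
          mul_le_mul' (mul_le_mul' ((hlw v hv).2.le_one 0 0) hb) ((hlw v hv).1.le_one 1 1)
      _ = _ := by rw [one_mul, mul_one]
  have hdiv' : TopRightDivisible (uniformizerAt v) 1 (((localComponent 2 K v y)⁻¹ :
      GL (Fin 2) (v.adicCompletion K)) : Matrix (Fin 2) (Fin 2) (v.adicCompletion K)) := by
    intro j k hj hk
    have hj0 : j = 0 := Fin.ext (by simp only [Fin.val_zero]; omega)
    have hk1 : k = 1 := Fin.ext (by have := k.isLt; simp only [Fin.val_one]; omega)
    subst hj0 hk1
    have hNinv : (ofLocal 2 K v (unipotentOfSqZero (Matrix.single (0 : Fin 2) (1 : Fin 2) b)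
        (single_zero_one_mul_self v b)))⁻¹ = ofLocal 2 K v (unipotentOfSqZero
        (Matrix.single (0 : Fin 2) (1 : Fin 2) (-b)) (single_zero_one_mul_self v (-b))) := by
      rw [← map_inv]
      congr 1
      exact Units.ext (by
        rw [coe_unipotentOfSqZero_inv, coe_unipotentOfSqZero, sub_eq_add_neg, Matrix.single_neg])
    have hyinv : y⁻¹ = l⁻¹ * ofLocal 2 K v (unipotentOfSqZero
        (Matrix.single (0 : Fin 2) (1 : Fin 2) (-b)) (single_zero_one_mul_self v (-b))) * l := by
      rw [hy, mul_inv_rev, mul_inv_rev, inv_inv, hNinv, mul_assoc]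
    rw [← map_inv, hyinv, coe_localComponent_conj_unipotent_apply, Matrix.one_apply_ne (by decide),
      zero_add, map_mul, map_mul, Valuation.map_neg]
    calc Valued.v ((((localComponent 2 K v l)⁻¹ : GL (Fin 2) (v.adicCompletion K)) :
          Matrix (Fin 2) (Fin 2) (v.adicCompletion K)) 0 0) * Valued.v b *
          Valued.v (((localComponent 2 K v l : GL (Fin 2) (v.adicCompletion K)) :
            Matrix (Fin 2) (Fin 2) (v.adicCompletion K)) 1 1)
        ≤ 1 * Valued.v ((uniformizerAt v : (v.adicCompletion K)ˣ) : v.adicCompletion K) * 1 :=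
          mul_le_mul' (mul_le_mul' ((hlw v hv).2.le_one 0 0) hb) ((hlw v hv).1.le_one 1 1)
      _ = _ := by rw [one_mul, mul_one]
  have hloc : tl⁻¹ * localComponent 2 K v y * tl ∈ iwahoriLevel 2 v r (max r 1) := by
    refine ⟨hyv.1.cutDiag_conj hϖ1 hdiv, ?_⟩
    have hinv : (tl⁻¹ * localComponent 2 K v y * tl)⁻¹ = tl⁻¹ * (localComponent 2 K v y)⁻¹ * tl := by
      group
    rw [hinv]
    exact hyv.2.cutDiag_conj hϖ1 hdiv'
  -- assemble the membership of `t⁻¹ y t`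
  rw [ht, conj_ofLocal_eq_mul_ofLocal', mem_hidaLevel_iff]
  refine ⟨mul_mem (h𝒰.mul_ofLocal_inv_mem v hv y hyS)
    (h𝒰.ofLocal_mem v hv _ (valuedIwahoriSubgroup_le_valuedCongruenceSubgroup_one hloc)),
    fun w hw => ?_⟩
  by_cases hwv : w = v
  · subst hwv
    simp only [map_mul, map_inv, localComponent_ofLocal, mul_inv_cancel, one_mul]
    exact hloc
  · simp only [map_mul, map_inv, localComponent_ofLocal_of_ne hwv, inv_one, mul_one]
    exact hyw w hw

/-- The diagonal entries of an element of the Iwahori level `Iw_v(r, max r 1)` and of its inverse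
are units. [folklore] -/
theorem valued_apply_eq_one_of_mem_iwahoriLevel {v : HeightOneSpectrum (𝓞 K)} {r : ℕ}
    {g : GL (Fin 2) (v.adicCompletion K)} (hg : g ∈ iwahoriLevel 2 v r (max r 1)) :
    Valued.v ((((g⁻¹ : GL (Fin 2) (v.adicCompletion K)) :
        Matrix (Fin 2) (Fin 2) (v.adicCompletion K)) 0 0)) = 1 ∧
      Valued.v (((g : GL (Fin 2) (v.adicCompletion K)) :
        Matrix (Fin 2) (Fin 2) (v.adicCompletion K)) 1 1) = 1 := by
  set A : Matrix (Fin 2) (Fin 2) (v.adicCompletion K) :=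
    ((g : GL (Fin 2) (v.adicCompletion K)) : Matrix (Fin 2) (Fin 2) (v.adicCompletion K)) with hA
  set A' : Matrix (Fin 2) (Fin 2) (v.adicCompletion K) :=
    ((g⁻¹ : GL (Fin 2) (v.adicCompletion K)) : Matrix (Fin 2) (Fin 2) (v.adicCompletion K)) with hA'
  have hlt : min (WithZero.exp (-(r : ℤ)) : WithZero (Multiplicative ℤ))
      (WithZero.exp (-((max r 1 : ℕ) : ℤ))) < 1 := by
    refine (min_le_right _ _).trans_lt ?_
    rw [← WithZero.exp_zero, WithZero.exp_lt_exp]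
    have : (1 : ℤ) ≤ ((max r 1 : ℕ) : ℤ) := by exact_mod_cast le_max_right r 1
    omega
  -- `(A' A)₀₀ = A'₀₀ A₀₀ + A'₀₁ A₁₀ = 1` and `(A A')₁₁ = A₁₀ A'₀₁ + A₁₁ A'₁₁ = 1`
  have h00 : A' 0 0 * A 0 0 + A' 0 1 * A 1 0 = 1 := by
    have h := congrFun (congrFun (Units.inv_mul g) 0) 0
    rw [Matrix.mul_apply, Fin.sum_univ_two, Matrix.one_apply_eq] at h
    exact h
  have h11 : A 1 0 * A' 0 1 + A 1 1 * A' 1 1 = 1 := by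
    have h := congrFun (congrFun (Units.mul_inv g) 1) 1
    rw [Matrix.mul_apply, Fin.sum_univ_two, Matrix.one_apply_eq] at h
    exact h
  have hsmall1 : Valued.v (A' 0 1 * A 1 0) < 1 := by
    rw [map_mul]
    calc Valued.v (A' 0 1) * Valued.v (A 1 0) ≤ 1 * min (WithZero.exp (-(r : ℤ)))
          (WithZero.exp (-((max r 1 : ℕ) : ℤ))) := mul_le_mul' (hg.2.le_one 0 1) (hg.1.lower 1 0 (by decide))
      _ < 1 := by rw [one_mul]; exact hlt
  have hsmall2 : Valued.v (A 1 0 * A' 0 1) < 1 := by rwa [mul_comm]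
  -- ultrametric: the other summand has valuation `1`
  have key : ∀ x y : v.adicCompletion K, x + y = 1 → Valued.v y < 1 → Valued.v x = 1 := by
    intro x y hxy hy
    have hx : x = 1 + -y := by rw [← hxy]; ring
    rw [hx]
    have h := Valued.v.map_add_eq_of_lt_left (x := (1 : v.adicCompletion K)) (y := -y)
      (by rwa [Valuation.map_one, Valuation.map_neg])
    rwa [Valuation.map_one] at h
  have e00 : Valued.v (A' 0 0 * A 0 0) = 1 := key _ _ h00 hsmall1
  have e11 : Valued.v (A 1 1 * A' 1 1) = 1 := key _ _ ((add_comm _ _).trans h11) hsmall2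
  rw [map_mul] at e00 e11
  constructor
  · refine le_antisymm (hg.2.le_one 0 0) ?_
    calc (1 : WithZero (Multiplicative ℤ)) = Valued.v (A' 0 0) * Valued.v (A 0 0) := e00.symm
      _ ≤ Valued.v (A' 0 0) * 1 := mul_le_mul' le_rfl (hg.1.le_one 0 0)
      _ = Valued.v (A' 0 0) := mul_one _
  · refine le_antisymm (hg.1.le_one 1 1) ?_
    calc (1 : WithZero (Multiplicative ℤ)) = Valued.v (A 1 1) * Valued.v (A' 1 1) := e11.symm
      _ ≤ Valued.v (A 1 1) * 1 := mul_le_mul' le_rfl (hg.2.le_one 1 1)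
      _ = Valued.v (A 1 1) := mul_one _

/-- **`n(1)` fixes no coset of `U(r) t_{v,1} U(r) / U(r)`**: for `l ∈ U(r)`,
`t⁻¹ (l⁻¹ ι_v(n(1)) l) t ∉ U(r)` — its `v`-component would be integral, forcing the top-right entry
`(l_v⁻¹)₀₀ (l_v)₁₁` (a unit) of `l_v⁻¹ n(1) l_v` to be divisible by `ϖ_v`
(`topRightDivisible_of_le_one`). [folklore] -/
theorem conj_not_mem_hidaLevel {v : HeightOneSpectrum (𝓞 K)} (hv : (p : 𝓞 K) ∈ v.asIdeal)
    {r : ℕ} {l : FiniteAdelicGL 2 K} (hl : l ∈ 𝒰.hidaLevel r) :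
    (heckeElement 2 K v 1)⁻¹ * (l⁻¹ * ofLocal 2 K v (unipotentOfSqZero
      (Matrix.single (0 : Fin 2) (1 : Fin 2) 1) (single_zero_one_mul_self v 1)) * l) *
      heckeElement 2 K v 1 ∉ 𝒰.hidaLevel r := by
  intro hmem
  set y : FiniteAdelicGL 2 K := l⁻¹ * ofLocal 2 K v (unipotentOfSqZero
    (Matrix.single (0 : Fin 2) (1 : Fin 2) 1) (single_zero_one_mul_self v 1)) * l with hy
  have hloc := ((mem_hidaLevel_iff 𝒰 r _).1 hmem).2 v hv
  rw [map_mul, map_mul, map_inv, localComponent_heckeElement_self] at hloc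
  have hdiv := topRightDivisible_of_le_one hloc.1.le_one
  have h01 := hdiv 0 1 (by decide) (by decide)
  rw [hy, coe_localComponent_conj_unipotent_apply, Matrix.one_apply_ne (by decide), zero_add,
    mul_one, map_mul] at h01
  obtain ⟨e00, e11⟩ := valued_apply_eq_one_of_mem_iwahoriLevel (((mem_hidaLevel_iff 𝒰 r l).1 hl).2 v hv)
  rw [e00, e11, one_mul, valued_coe_uniformizerAt, ← WithZero.exp_zero, WithZero.exp_le_exp] at h01
  omega

/-! ### `p` divides the number of cosets in `U(r) t_{v,1} U(r)` -/

/-- `n(b)^m = n(m b)` (`(1 + N)^m = 1 + m N` for `N² = 0`). [folklore] -/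
theorem unipotent_pow (v : HeightOneSpectrum (𝓞 K)) (b : v.adicCompletion K) (m : ℕ) :
    unipotentOfSqZero (Matrix.single (0 : Fin 2) (1 : Fin 2) b) (single_zero_one_mul_self v b) ^ m =
      unipotentOfSqZero (Matrix.single (0 : Fin 2) (1 : Fin 2) ((m : v.adicCompletion K) * b))
        (single_zero_one_mul_self v _) := by
  have hcb : ∀ c : v.adicCompletion K,
      Matrix.single (0 : Fin 2) (1 : Fin 2) c * Matrix.single (0 : Fin 2) (1 : Fin 2) b = 0 :=
    fun c => Matrix.single_mul_single_of_ne c 0 1 0 (by decide) b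
  refine Units.ext ?_
  rw [Units.val_pow_eq_pow_val, coe_unipotentOfSqZero, coe_unipotentOfSqZero]
  induction m with
  | zero => simp
  | succ m ih =>
    rw [pow_succ, ih, Nat.cast_succ, add_mul (m : v.adicCompletion K) 1 b, one_mul,
      Matrix.single_add]
    simp only [add_mul, mul_add, one_mul, mul_one, hcb, add_zero]
    abel

/-- **`p ∣ #(U(r) t_{v,1} U(r) / U(r))`** for `v ∣ p` and `U` maximal above `p`: the permutation
`σ = ι_v(n(1)) • ·` of the finite set `U(r) t U(r) / U(r)` satisfies `σ^p = ι_v(n(p)) • · = 1`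
(`|p|_v ≤ |ϖ_v|`, `conj_mem_hidaLevel_of_valued_le`) and has no fixed point
(`conj_not_mem_hidaLevel`), so the cardinality is `≡ 0 (mod p)`
(`Equiv.Perm.card_fixedPoints_modEq`). [folklore] -/
theorem dvd_card_doubleCosetQuot_hidaLevel (h𝒰 : 𝒰.IsMaximalAbove) {v : HeightOneSpectrum (𝓞 K)}
    (hv : (p : 𝓞 K) ∈ v.asIdeal) (r : ℕ)
    (hfin : (ArithmeticQuotient.doubleCosetQuot (𝒰.hidaLevel r) (heckeElement 2 K v 1)).Finite) :
    p ∣ hfin.toFinset.card := by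
  classical
  set L := 𝒰.hidaLevel r with hL
  set t : FiniteAdelicGL 2 K := heckeElement 2 K v 1 with ht
  set X := ArithmeticQuotient.doubleCosetQuot L t with hX
  haveI : Fintype X := hfin.fintype
  set N1 : FiniteAdelicGL 2 K := ofLocal 2 K v (unipotentOfSqZero
    (Matrix.single (0 : Fin 2) (1 : Fin 2) 1) (single_zero_one_mul_self v 1)) with hN1
  have hN1L : N1 ∈ L := ofLocal_unipotent_mem_hidaLevel h𝒰 hv (by rw [Valuation.map_one]) r
  -- the permutation `σ d = N1 • d`
  have hmem : ∀ d : X, N1 • (d : FiniteAdelicGL 2 K ⧸ L) ∈ X := fun d =>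
    ArithmeticQuotient.coe_smul_mem_doubleCosetQuot d.2 ⟨N1, hN1L⟩
  set σ : Function.End X := fun d => ⟨N1 • (d : FiniteAdelicGL 2 K ⧸ L), hmem d⟩ with hσ
  have hσpow : ∀ (m : ℕ) (d : X), (((σ ^ m) d : X) : FiniteAdelicGL 2 K ⧸ L) =
      N1 ^ m • (d : FiniteAdelicGL 2 K ⧸ L) := by
    intro m
    induction m with
    | zero => intro d; rw [pow_zero, pow_zero, one_smul]; rfl
    | succ m ih =>
      intro d
      rw [pow_succ', pow_succ', mul_smul]
      change N1 • (((σ ^ m) d : X) : FiniteAdelicGL 2 K ⧸ L) = _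
      rw [ih]
  -- every element of `X` is `l t L` with `l ∈ L`
  have hrep : ∀ d : X, ∃ l : FiniteAdelicGL 2 K, l ∈ L ∧
      (d : FiniteAdelicGL 2 K ⧸ L) = ((l * t : FiniteAdelicGL 2 K) : FiniteAdelicGL 2 K ⧸ L) := by
    intro d
    obtain ⟨l, hl⟩ := MulAction.mem_orbit_iff.1 d.2
    refine ⟨l, l.2, ?_⟩
    rw [← hl]
    change (l : FiniteAdelicGL 2 K) • (t : FiniteAdelicGL 2 K ⧸ L) = _
    rw [MulAction.Quotient.smul_coe]
    rfl
  -- `N(b) • (l t L) = l t L ↔ t⁻¹ (l⁻¹ N(b) l) t ∈ L`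
  have hfix : ∀ (N l : FiniteAdelicGL 2 K),
      N • ((l * t : FiniteAdelicGL 2 K) : FiniteAdelicGL 2 K ⧸ L) =
        ((l * t : FiniteAdelicGL 2 K) : FiniteAdelicGL 2 K ⧸ L) ↔ t⁻¹ * (l⁻¹ * N * l) * t ∈ L := by
    intro N l
    rw [MulAction.Quotient.smul_coe, smul_eq_mul, eq_comm, QuotientGroup.eq,
      show (l * t)⁻¹ * (N * (l * t)) = t⁻¹ * (l⁻¹ * N * l) * t by group]
  -- `σ ^ p = 1`
  have hpmem : Valued.v ((p : ℕ) : v.adicCompletion K) ≤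
      Valued.v ((uniformizerAt v : (v.adicCompletion K)ˣ) : v.adicCompletion K) := by
    rw [valued_coe_uniformizerAt]
    have h : ((p : ℕ) : v.adicCompletion K) = algebraMap K (v.adicCompletion K) ((p : 𝓞 K) : K) := by
      simp
    rw [h]
    change Valued.v ((((p : 𝓞 K) : K)) : v.adicCompletion K) ≤ _
    rw [HeightOneSpectrum.valuedAdicCompletion_eq_valuation', HeightOneSpectrum.valuation_of_algebraMap]
    have h1 : v.intValuation (p : 𝓞 K) ≤ WithZero.exp (-((1 : ℕ) : ℤ)) :=
      (v.intValuation_le_pow_iff_mem _ 1).2 (by rwa [pow_one])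
    rwa [Nat.cast_one] at h1
  have hσp : σ ^ p ^ 1 = 1 := by
    rw [pow_one]
    funext d
    apply Subtype.ext
    rw [hσpow]
    obtain ⟨l, hl, hd⟩ := hrep d
    change N1 ^ p • (d : FiniteAdelicGL 2 K ⧸ L) = (d : FiniteAdelicGL 2 K ⧸ L)
    rw [hd, hfix, hN1, ← map_pow, unipotent_pow]
    exact conj_mem_hidaLevel_of_valued_le h𝒰 hv hl (by rw [mul_one]; exact hpmem)
  -- no fixed points
  have hnofix : Function.fixedPoints σ = ∅ := by
    refine Set.eq_empty_iff_forall_notMem.2 fun d hd => ?_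
    obtain ⟨l, hl, hdl⟩ := hrep d
    have h := congrArg (fun e : X => (e : FiniteAdelicGL 2 K ⧸ L)) hd
    change N1 • (d : FiniteAdelicGL 2 K ⧸ L) = (d : FiniteAdelicGL 2 K ⧸ L) at h
    rw [hdl, hfix] at h
    exact conj_not_mem_hidaLevel hv hl h
  have hmod := Equiv.Perm.card_fixedPoints_modEq hσp
  rw [Set.Finite.card_toFinset]
  refine (Nat.modEq_zero_iff_dvd.1 ?_)
  have h0 : Fintype.card (Function.fixedPoints σ) = 0 := by
    rw [Fintype.card_eq_zero_iff]
    exact ⟨fun x => Set.notMem_empty x.1 (hnofix ▸ x.2)⟩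
  rwa [h0] at hmod

/-! ### No ordinary part in degree `0` -/

/-- **`U_{v,1}^s = 0` on `H⁰(X_{U(r)}, ℤ/p^s)`** (`GL₂`, `U` maximal above `p`, `v ∣ p`): on
invariant functions `U_{v,1}^s` is `#(UtU/U)^s • f(· t^s)` (`GL2AdelicInvariantFunctionsDet`)
and `p^s ∣ #(UtU/U)^s` kills `ℤ/p^s`. [folklore] -/
theorem hidaFamily_heckeElement_zero_pow_eq_zero (h𝒰 : 𝒰.IsMaximalAbove)
    {v : HeightOneSpectrum (𝓞 K)} (hv : (p : 𝓞 K) ∈ v.asIdeal) (r s : ℕ) :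
    𝒰.hidaFamily ℤ (heckeElement 2 K v 1) (0, r, s) ^ s = 0 := by
  classical
  have hfin : (ArithmeticQuotient.doubleCosetQuot (𝒰.hidaLevel r) (heckeElement 2 K v 1)).Finite :=
    finite_orbit_quotient (𝒰.hidaLevel r) _
  obtain ⟨c, hc⟩ := dvd_card_doubleCosetQuot_hidaLevel h𝒰 hv r hfin
  change ArithmeticQuotient.heckeEnd ℤ (𝒰.hidaLevel r) (heckeElement 2 K v 1) (modPow ℤ (p : ℤ) s)
    (globalEmbedding 2 K) 0 ^ s = 0
  refine ArithmeticQuotient.heckeEnd_zero_pow_eq_zero ℤ (globalEmbedding 2 K) (𝒰.hidaLevel r)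
    (heckeElement 2 K v 1) (modPow ℤ (p : ℤ) s) fun f hf => funext fun d => ?_
  induction d using QuotientGroup.induction_on with
  | H x =>
    rw [heckeFun_pow_apply_coe_of_forall_coeffRepresentation_eq (𝒰.isOpen_hidaLevel r) _ hfin s hf x,
      Pi.zero_apply, hc, mul_pow, mul_smul]
    -- `p^s • y = 0` in `ℤ/p^s`
    generalize (c ^ s • f (((x * heckeElement 2 K v 1 ^ s : FiniteAdelicGL 2 K)) :
      FiniteAdelicGL 2 K ⧸ 𝒰.hidaLevel r)) = y
    obtain ⟨z, rfl⟩ := Ideal.Quotient.mk_surjective y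
    rw [nsmul_eq_mul, ← map_natCast (Ideal.Quotient.mk (Ideal.span {(p : ℤ) ^ s})) (p ^ s),
      ← map_mul, Ideal.Quotient.eq_zero_iff_mem, Nat.cast_pow]
    exact Ideal.mul_mem_right _ _ (Ideal.mem_span_singleton_self _)

/-- **The Hida tower of `GL₂` has no ordinary part in degree `0`**: for `U` maximal above `p`,
`H⁰(X_{U(r)}, ℤ/p^s)^{ord} = 0`, i.e. the degree-`0` factors contribute nothing to the ordinary
big Hecke algebra `𝕋^{S,ord}(𝒰)` (the printed theory's degrees are `1 ≤ i ≤ 2` for Bianchi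
manifolds, `q = r₁ + r₂` in [cite: Hida1994AIF, Thm. 2.2]; [cite: KhareThorne2017, §6.3]). -/
theorem ordinaryPart_zero_eq_bot (h𝒰 : 𝒰.IsMaximalAbove) (r s : ℕ) :
    𝒰.ordinaryPart ℤ (0, r, s) = ⊥ := by
  -- a place above `p`
  obtain ⟨v, hv⟩ : ∃ v : HeightOneSpectrum (𝓞 K), (p : 𝓞 K) ∈ v.asIdeal := by
    have hp : (Ideal.span {(p : 𝓞 K)} : Ideal (𝓞 K)) ≠ ⊤ := by
      rw [Ne, Ideal.span_singleton_eq_top]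
      intro hu
      have h := hu.map (Algebra.norm ℤ)
      rw [show (p : 𝓞 K) = algebraMap ℤ (𝓞 K) (p : ℤ) by simp, Algebra.norm_algebraMap] at h
      have hd : Module.finrank ℤ (𝓞 K) ≠ 0 := Module.finrank_pos.ne'
      rw [isUnit_pow_iff hd, Int.isUnit_iff] at h
      have hp2 := (Fact.out : p.Prime).two_le
      omega
    obtain ⟨𝔪, h𝔪, hle⟩ := Ideal.exists_le_maximal _ hp
    have h𝔪0 : 𝔪 ≠ ⊥ := fun h => by
      rw [h, le_bot_iff, Ideal.span_singleton_eq_bot] at hle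
      exact (Fact.out : p.Prime).ne_zero (by exact_mod_cast hle)
    exact ⟨⟨𝔪, h𝔪.isPrime, h𝔪0⟩, hle (Ideal.mem_span_singleton_self _)⟩
  rw [eq_bot_iff, ordinaryPart]
  refine (iInf_le_of_le (⟨v, hv⟩ : {v : HeightOneSpectrum (𝓞 K) // (p : 𝓞 K) ∈ v.asIdeal})
    (iInf_le_of_le (⟨0, by norm_num⟩ : Fin (2 - 1)) (iInf_le _ s))).trans ?_
  rw [ordSpan, Submodule.span_le]
  rintro _ ⟨T, -, z, rfl⟩
  change T ((𝒰.hidaFamily ℤ (heckeElement 2 K v (0 + 1)) (0, r, s) ^ s) z) ∈ (⊥ : Submodule ℤ _)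
  rw [zero_add, hidaFamily_heckeElement_zero_pow_eq_zero h𝒰 hv r s]
  have hT0 : T ((0 : 𝒰.HidaEndFactor ℤ (0, r, s)) z) = 0 :=
    (HidaEndFactor.toEnd 𝒰 ℤ T).map_zero
  rw [hT0]
  exact Submodule.zero_mem _

end TameLevel

end Literature.NumberTheory.Automorphic.BigHeckeGLn
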